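import Mathlib

/-!
# Heegner pattern budget at exponent `θ = 1` (CRT) — stub `stub_heegnerPatternBudgetCRT` of line
# `SketchIdeator1` (card waldspurger-localisation), crux stmt-ABC-15174
# `Summit.ABC.ABC.Theses.RibetTakahashiSplit.ManyPrimeValuationProductSemistableFrey`

`HeegnerPatternBudget θ` (skeleton `Cruxes/ManyPrimeValuationProductSemistableFrey/Lines/SketchIdeator1.lean`):
for every squarefree `N` and every sign pattern `σ` on its odd primes there is `0 < d ≤ C N^{θ+ε}` with
`jacobiSym (−d) p ≠ 0` and `jacobiSym (−d) p = 1 ↔ σ p` at every odd prime `p ∣ N`.  At `θ = 1` this is the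
Chinese remainder theorem: pick a non-zero residue class `r_p (mod p)` with `(r_p / p) = ±1` as prescribed
(both a non-zero square and a non-square exist modulo an odd prime), solve `−d ≡ r_p (mod p)` for all odd
`p ∣ N` simultaneously with `0 < d ≤ ∏_{odd p ∣ N} p ≤ N ≤ 1 · N^{1+ε}`.
-/

set_option linter.dupNamespace false

namespace Summit.ABC.ABC.Theorems.ManyPrimeValuationProductSemistableFrey

/-- CRT step: for a finite set `S` of primes and target residues `t p` with `p ∤ t p`, there is
`0 < d ≤ ∏_{p ∈ S} p` with `d ≡ t p (mod p)` for every `p ∈ S` (induction on `S`, two-modulus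
`Nat.chineseRemainder` at each step). -/
private lemma exists_pos_le_prod_modEq (S : Finset ℕ) (hS : ∀ p ∈ S, p.Prime) (t : ℕ → ℕ)
    (ht : ∀ p ∈ S, ¬ p ∣ t p) :
    ∃ d : ℕ, 0 < d ∧ d ≤ ∏ p ∈ S, p ∧ ∀ p ∈ S, d ≡ t p [MOD p] := by
  induction S using Finset.induction_on with
  | empty => exact ⟨1, Nat.one_pos, by simp, by simp⟩
  | insert q S hq ih =>
    obtain ⟨d₀, -, hd₀le, hd₀mod⟩ := ih (fun p hp => hS p (Finset.mem_insert_of_mem hp))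
      (fun p hp => ht p (Finset.mem_insert_of_mem hp))
    have hqS : q ∈ insert q S := Finset.mem_insert_self q S
    have hqprime : q.Prime := hS q hqS
    have hcop : Nat.Coprime q (∏ p ∈ S, p) :=
      Nat.Coprime.prod_right fun p hp =>
        (Nat.coprime_primes hqprime (hS p (Finset.mem_insert_of_mem hp))).mpr
          fun h => hq (h ▸ hp)
    have hP0 : (∏ p ∈ S, p) ≠ 0 :=
      Finset.prod_ne_zero_iff.mpr fun p hp => (hS p (Finset.mem_insert_of_mem hp)).ne_zero
    let x := Nat.chineseRemainder hcop (t q) d₀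
    have hxlt : (x : ℕ) < q * ∏ p ∈ S, p :=
      Nat.chineseRemainder_lt_mul hcop (t q) d₀ hqprime.ne_zero hP0
    have hxq : (x : ℕ) ≡ t q [MOD q] := x.2.1
    have hxS : (x : ℕ) ≡ d₀ [MOD ∏ p ∈ S, p] := x.2.2
    refine ⟨x, ?_, ?_, ?_⟩
    · refine Nat.pos_of_ne_zero fun hx0 => ht q hqS ?_
      rw [hx0] at hxq
      exact Nat.modEq_zero_iff_dvd.mp hxq.symm
    · rw [Finset.prod_insert hq]
      exact hxlt.le
    · intro p hp
      rcases Finset.mem_insert.mp hp with rfl | hp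
      · exact hxq
      · exact (hxS.of_dvd (Finset.dvd_prod_of_mem (fun p : ℕ => p) hp)).trans (hd₀mod p hp)

/-- At an odd prime `p`: a residue `r` with `p ∤ r` such that every `d ≡ r (mod p)` has
`J(-d | p) ≠ 0` and (`J(-d | p) = 1 ↔ b`).  Take `r ≡ -c` with `c = 1` if `b`, and `c` a
non-square (`FiniteField.exists_nonsquare`) otherwise. -/
private lemma exists_residue_jacobiSym_neg (p : ℕ) (hp : p.Prime) (hp2 : p ≠ 2) (b : Bool) :
    ∃ r : ℕ, ¬ p ∣ r ∧ ∀ d : ℕ, d ≡ r [MOD p] →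
      jacobiSym (-(d : ℤ)) p ≠ 0 ∧ (jacobiSym (-(d : ℤ)) p = 1 ↔ b = true) := by
  haveI := Fact.mk hp
  obtain ⟨c, hc0, hcb⟩ : ∃ c : ZMod p, c ≠ 0 ∧ (IsSquare c ↔ b = true) := by
    cases b with
    | false =>
      obtain ⟨a, ha⟩ := FiniteField.exists_nonsquare (F := ZMod p)
        (by rw [ZMod.ringChar_zmod_n]; exact hp2)
      exact ⟨a, fun h0 => ha (h0 ▸ IsSquare.zero), by simp [ha]⟩
    | true => exact ⟨1, one_ne_zero, by simp⟩
  refine ⟨(-c).val, fun h => hc0 ?_, fun d hd => ?_⟩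
  · have h1 : (((-c).val : ℕ) : ZMod p) = 0 := (ZMod.natCast_eq_zero_iff _ _).mpr h
    rw [ZMod.natCast_zmod_val] at h1
    exact neg_eq_zero.mp h1
  · have hd' : (d : ZMod p) = -c := by
      rw [← ZMod.natCast_zmod_val (-c)]
      exact (ZMod.natCast_eq_natCast_iff' _ _ _).mpr hd
    have hJ : jacobiSym (-(d : ℤ)) p = quadraticChar (ZMod p) c := by
      rw [← jacobiSym.legendreSym.to_jacobiSym, legendreSym, Int.cast_neg, Int.cast_natCast,
        hd', neg_neg]
    rw [hJ]
    exact ⟨fun h => hc0 (quadraticChar_eq_zero_iff.mp h),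
      (quadraticChar_one_iff_isSquare hc0).trans hcb⟩

/-- **Heegner pattern budget at exponent `1` (CRT).** For every `ε > 0` there is `C` (indeed `C = 1`)
such that for every squarefree `N` and every `σ : ℕ → Bool` there is `0 < d ≤ C N^{1+ε}` with
`jacobiSym (−d) p ≠ 0` and (`jacobiSym (−d) p = 1 ↔ σ p = true`) for every odd prime `p ∣ N`.
= the skeleton's `HeegnerPatternBudget 1`, unfolded. [folklore] -/
theorem heegnerPatternBudget_one :
    ∀ ε : ℝ, 0 < ε → ∃ C : ℝ, ∀ N : ℕ, Squarefree N → ∀ σ : ℕ → Bool,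
      ∃ d : ℕ, 0 < d ∧ (d : ℝ) ≤ C * (N : ℝ) ^ ((1 : ℝ) + ε) ∧
        ∀ p ∈ N.primeFactors, p ≠ 2 →
          jacobiSym (-(d : ℤ)) p ≠ 0 ∧ (jacobiSym (-(d : ℤ)) p = 1 ↔ σ p = true) := by
  intro ε hε
  refine ⟨1, fun N hN σ => ?_⟩
  -- target residues at the odd primes (arbitrary elsewhere)
  have key : ∀ p : ℕ, ∃ r : ℕ, p.Prime → p ≠ 2 → (¬ p ∣ r ∧ ∀ d : ℕ, d ≡ r [MOD p] →
      jacobiSym (-(d : ℤ)) p ≠ 0 ∧ (jacobiSym (-(d : ℤ)) p = 1 ↔ σ p = true)) := by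
    intro p
    by_cases h : p.Prime ∧ p ≠ 2
    · obtain ⟨r, hr⟩ := exists_residue_jacobiSym_neg p h.1 h.2 (σ p)
      exact ⟨r, fun _ _ => hr⟩
    · exact ⟨0, fun h1 h2 => (h ⟨h1, h2⟩).elim⟩
  choose t ht using key
  set S := N.primeFactors.filter (· ≠ 2) with hS_def
  have hSprime : ∀ p ∈ S, p.Prime := fun p hp =>
    Nat.prime_of_mem_primeFactors (Finset.mem_filter.mp hp).1
  have hSt : ∀ p ∈ S, ¬ p ∣ t p := fun p hp =>
    (ht p (hSprime p hp) (Finset.mem_filter.mp hp).2).1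
  obtain ⟨d, hdpos, hdle, hdmod⟩ := exists_pos_le_prod_modEq S hSprime t hSt
  have hNpos : 0 < N := Nat.pos_of_ne_zero hN.ne_zero
  have hprod_dvd : (∏ p ∈ S, p) ∣ N := by
    have h1 : (∏ p ∈ S, p) ∣ ∏ p ∈ N.primeFactors, p :=
      Finset.prod_dvd_prod_of_subset _ _ _ (Finset.filter_subset _ _)
    rwa [Nat.prod_primeFactors_of_squarefree hN] at h1
  have hdN : d ≤ N := hdle.trans (Nat.le_of_dvd hNpos hprod_dvd)
  refine ⟨d, hdpos, ?_, fun p hp hp2 => ?_⟩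
  · have hN1 : (1 : ℝ) ≤ N := by exact_mod_cast Nat.one_le_iff_ne_zero.mpr hN.ne_zero
    calc (d : ℝ) ≤ N := by exact_mod_cast hdN
      _ = (N : ℝ) ^ (1 : ℝ) := (Real.rpow_one _).symm
      _ ≤ (N : ℝ) ^ ((1 : ℝ) + ε) := Real.rpow_le_rpow_of_exponent_le hN1 (by linarith)
      _ = 1 * (N : ℝ) ^ ((1 : ℝ) + ε) := (one_mul _).symm
  · exact (ht p (Nat.prime_of_mem_primeFactors hp) hp2).2 d
      (hdmod p (Finset.mem_filter.mpr ⟨hp, hp2⟩))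

end Summit.ABC.ABC.Theorems.ManyPrimeValuationProductSemistableFrey
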